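import Mathlib
import Literature.NumberTheory.Transcendental.KZCalculus
import Literature.NumberTheory.Transcendental.KZLogCalculusProofs
import Summits.KontsevichZagierPeriods.KontsevichZagierPeriods.Theorems.TorsionLogsGKZLevelThreePairBetaCubic
import HarnessLib

/-!
# `BetaLinearSector` (stmt-KontsevichZagierPeriods-3897), line `fermat-sector-transport` — stub `stub_quarticRational_equivalent_beta`

Euler's reflection formula at `1/4` inside the Kontsevich–Zagier calculus of moves, step 1 (of 4) of
the `π`-class of the LEVEL-4 rung (`a, b, a', b' ∈ ¼ℤ`) of the crux `BetaLinearSector` (route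
FermatIsogeny): the Beta cell `[(0,1), x^{-3/4}(1-x)^{-1/4}]` (value `B(1/4,3/4) = Γ(1/4)Γ(3/4) = π√2`)
is made RATIONAL by ONE change of variables (rule (2)),
`x = φ(w) = w⁴/(w⁴ + (1-w)⁴)` from `(0,1)` onto `(0,1)` (strictly increasing, `φ(0) = 0`, `φ(1) = 1`).
With `Q(w) = w⁴ + (1-w)⁴ > 0`: `1 - φ(w) = (1-w)⁴/Q(w)`, `φ'(w) = 4w³(1-w)³/Q(w)²`, and the pull-back
identity on `(0,1)`

  `φ(w)^{-3/4} · (1-φ(w))^{-1/4} · φ'(w) = (Q^{3/4}/w³) · (Q^{1/4}/(1-w)) · 4w³(1-w)³/Q² = 4(1-w)²/Q(w)`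

(`quartic_subst_pullback`), whence `[(0,1), 4(1-w)²/(w⁴+(1-w)⁴)] ∼ [(0,1), x^{-3/4}(1-x)^{-1/4}]`
(`stub_quarticRational_equivalent_beta`). The structure is that of the cubic case
`Summit.KontsevichZagierPeriods.KontsevichZagierPeriods.Theorems.GKZLevelThree.cubicRational_equivalent_beta`
(`TorsionLogsGKZLevelThreePairBetaCubic.lean`), whose one-dimensional bookkeeping
(`isSemialgebraicFunOn_ratFun₁`) and the packaging lemma
`of_sub_of_mem_changeOfVariablesRel_dimOne` are reused. Both representations are PINNED by their
domain and their integrand on it.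

References: M. Kontsevich, D. Zagier, *Periods* (2001), §1.2 rule (2); G. E. Andrews, R. Askey,
R. Roy, *Special Functions* (1999), Thm. 1.2.1 (Euler's reflection formula).
-/

noncomputable section

namespace Summit.KontsevichZagierPeriods.FermatIsogeny.BetaLinearSector.Quarters

open Set MeasureTheory
open MvPolynomial (aeval X C)
open Literature.NumberTheory.Transcendental
open Summit.KontsevichZagierPeriods.HermiteRigidity.CMTwistQuasiPeriodTransfer
  (of_sub_of_mem_changeOfVariablesRel_dimOne)
open Summit.KontsevichZagierPeriods.KontsevichZagierPeriods.Theorems.GKZLevelThree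
  (isSemialgebraicFunOn_ratFun₁)

/-! ## The substitution `x = w⁴/(w⁴ + (1-w)⁴)` -/

/-- The denominator `Q(w) = w⁴ + (1-w)⁴ = 1/8 + 3(w - 1/2)² + 2(w - 1/2)⁴` is positive. -/
theorem quartic_den_pos (w : ℝ) : 0 < w ^ 4 + (1 - w) ^ 4 := by
  nlinarith [sq_nonneg (w - 1/2), sq_nonneg ((w - 1/2) ^ 2)]

/-- The derivative of `φ(w) = w⁴/(w⁴ + (1-w)⁴)` is `4w³(1-w)³/(w⁴ + (1-w)⁴)²`. -/
theorem quartic_hasDerivAt_subst (w : ℝ) :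
    HasDerivAt (fun w : ℝ => w ^ 4 / (w ^ 4 + (1 - w) ^ 4))
      (4 * w ^ 3 * (1 - w) ^ 3 / (w ^ 4 + (1 - w) ^ 4) ^ 2) w := by
  have hq : (w ^ 4 + (1 - w) ^ 4) ≠ 0 := (quartic_den_pos w).ne'
  have h1 : HasDerivAt (fun w : ℝ => w ^ 4) (4 * w ^ 3) w := by
    simpa using hasDerivAt_pow 4 w
  have h2 : HasDerivAt (fun w : ℝ => w ^ 4 + (1 - w) ^ 4) (4 * w ^ 3 - 4 * (1 - w) ^ 3) w := by
    have h := (hasDerivAt_pow 4 w).add (((hasDerivAt_id' w).const_sub (1:ℝ)).pow 4)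
    exact h.congr_deriv (by push_cast; ring)
  exact (h1.div h2 hq).congr_deriv (by ring)

/-- `φ = w⁴/(w⁴ + (1-w)⁴)` is strictly increasing on `[0,1]`. -/
theorem quartic_strictMonoOn_subst :
    StrictMonoOn (fun w : ℝ => w ^ 4 / (w ^ 4 + (1 - w) ^ 4)) (Icc 0 1) := by
  refine strictMonoOn_of_deriv_pos (convex_Icc 0 1) ?_ fun w hw => ?_
  · exact (continuousOn_id.pow 4).div (by fun_prop) fun w _ => (quartic_den_pos w).ne'
  · rw [interior_Icc] at hw
    rw [(quartic_hasDerivAt_subst w).deriv]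
    have h1 : 0 < w := hw.1
    have h2 : 0 < 1 - w := by linarith [hw.2]
    have h3 := quartic_den_pos w
    positivity

/-- `φ` maps `(0,1)` onto `(0,1)` (`φ(0) = 0`, `φ(1) = 1`, intermediate values). -/
theorem quartic_image_subst :
    (fun w : ℝ => w ^ 4 / (w ^ 4 + (1 - w) ^ 4)) '' Ioo 0 1 = Ioo 0 1 := by
  set φ : ℝ → ℝ := fun w => w ^ 4 / (w ^ 4 + (1 - w) ^ 4) with hφ
  have hφ0 : φ 0 = 0 := by simp [hφ]
  have hφ1 : φ 1 = 1 := by norm_num [hφ]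
  have hcont : ContinuousOn φ (Icc 0 1) :=
    (continuousOn_id.pow 4).div (by fun_prop) fun w _ => (quartic_den_pos w).ne'
  apply Subset.antisymm
  · rintro _ ⟨w, hw, rfl⟩
    have hm := quartic_strictMonoOn_subst
    refine ⟨?_, ?_⟩
    · simpa [hφ0] using hm (left_mem_Icc.2 zero_le_one) (Ioo_subset_Icc_self hw) hw.1
    · simpa [hφ1] using hm (Ioo_subset_Icc_self hw) (right_mem_Icc.2 zero_le_one) hw.2
  · intro y hy
    obtain ⟨w, hw, hwy⟩ : y ∈ φ '' Icc 0 1 := by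
      have := intermediate_value_Icc zero_le_one hcont
      rw [hφ0, hφ1] at this
      exact this (Ioo_subset_Icc_self hy)
    refine ⟨w, ⟨?_, ?_⟩, hwy⟩
    · rcases hw.1.lt_or_eq with h | h
      · exact h
      · exfalso; rw [← h, hφ0] at hwy; linarith [hy.1]
    · rcases hw.2.lt_or_eq with h | h
      · exact h
      · exfalso; rw [h, hφ1] at hwy; linarith [hy.2]

/-- The pull-back identity of step 1: for `0 < w < 1`, `x = w⁴/Q`, `Q = w⁴ + (1-w)⁴`,
`x^{-3/4} (1-x)^{-1/4} · (4w³(1-w)³/Q²) = 4(1-w)²/Q`. -/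
theorem quartic_subst_pullback {w : ℝ} (hw : w ∈ Ioo (0:ℝ) 1) :
    (w ^ 4 / (w ^ 4 + (1 - w) ^ 4)) ^ (-(3:ℝ) / 4) *
        (1 - w ^ 4 / (w ^ 4 + (1 - w) ^ 4)) ^ (-(1:ℝ) / 4) *
        (4 * w ^ 3 * (1 - w) ^ 3 / (w ^ 4 + (1 - w) ^ 4) ^ 2) =
      4 * (1 - w) ^ 2 / (w ^ 4 + (1 - w) ^ 4) := by
  set q : ℝ := w ^ 4 + (1 - w) ^ 4 with hq
  have hq0 : 0 < q := quartic_den_pos w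
  have hw0 : 0 < w := hw.1
  have hw1 : 0 < 1 - w := by linarith [hw.2]
  have h4 : (4:ℕ) ≠ 0 := by norm_num
  -- `(w⁴/q)^{-3/4} = (q^{1/4})³/w³`
  have hA : (w ^ 4 / q) ^ (-(3:ℝ) / 4) = (q ^ ((4:ℕ)⁻¹ : ℝ)) ^ 3 / w ^ 3 := by
    rw [show (-(3:ℝ) / 4) = -(((4:ℕ)⁻¹ : ℝ) * 3) by norm_num, Real.rpow_neg (by positivity),
      Real.div_rpow (by positivity) hq0.le, Real.rpow_mul (by positivity), Real.rpow_mul hq0.le,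
      Real.pow_rpow_inv_natCast hw0.le h4, inv_div]
    norm_num
  -- `(1 - w⁴/q)^{-1/4} = q^{1/4}/(1-w)`
  have h1s : 1 - w ^ 4 / q = (1 - w) ^ 4 / q := by
    rw [eq_div_iff hq0.ne', sub_mul, div_mul_cancel₀ _ hq0.ne', hq]
    ring
  have hB : (1 - w ^ 4 / q) ^ (-(1:ℝ) / 4) = q ^ ((4:ℕ)⁻¹ : ℝ) / (1 - w) := by
    rw [h1s, show (-(1:ℝ) / 4) = -((4:ℕ)⁻¹ : ℝ) by norm_num, Real.rpow_neg (by positivity),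
      Real.div_rpow (by positivity) hq0.le, Real.pow_rpow_inv_natCast hw1.le h4, inv_div]
  -- `c = q^{1/4}`, `c⁴ = q`
  set c : ℝ := q ^ ((4:ℕ)⁻¹ : ℝ) with hc
  have hc4 : c ^ 4 = q := Real.rpow_inv_natCast_pow hq0.le h4
  have hc0 : c ≠ 0 := by
    intro h0
    rw [h0] at hc4
    norm_num at hc4
    exact hq0.ne' hc4.symm
  rw [hA, hB, ← hc4]
  have hw0' : w ≠ 0 := hw0.ne'
  have hw1' : (1 - w) ≠ 0 := hw1.ne'
  field_simp

/-- **Step 1 (Euler's reflection at `1/4`).**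
`[(0,1), 4(1-w)²/(w⁴+(1-w)⁴)] ∼ [(0,1), x^{-3/4}(1-x)^{-1/4}]` by ONE change of variables
`x = w⁴/(w⁴ + (1-w)⁴)` (rule (2)): `ℚ`-rational, strictly increasing from `(0,1)` onto `(0,1)`, with
the pull-back identity `quartic_subst_pullback`. [cite: KontsevichZagier2001, §1.2 rule (2)] -/
theorem stub_quarticRational_equivalent_beta : ∀ (W β : KZ.IntegralRep 1),
    W.domain = {x | x 0 ∈ Set.Ioo (0:ℝ) 1} →
    Set.EqOn W.integrand (fun x => 4 * (1 - x 0) ^ 2 / ((x 0) ^ 4 + (1 - x 0) ^ 4)) W.domain →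
    β.domain = {x | x 0 ∈ Set.Ioo (0:ℝ) 1} →
    Set.EqOn β.integrand (fun x => (x 0) ^ (-(3:ℝ) / 4) * (1 - x 0) ^ (-(1:ℝ) / 4)) β.domain →
    KZ.Equivalent W β := by
  intro W β hWd hWi hβd hβi
  set φ : ℝ → ℝ := fun w => w ^ 4 / (w ^ 4 + (1 - w) ^ 4) with hφ
  set φ' : ℝ → ℝ := fun w => 4 * w ^ 3 * (1 - w) ^ 3 / (w ^ 4 + (1 - w) ^ 4) ^ 2 with hφ'
  refine KZ.changeOfVariablesRel_subset_relations
    (of_sub_of_mem_changeOfVariablesRel_dimOne W β φ φ' ?_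
      (fun p _ => quartic_hasDerivAt_subst (p 0)) ?_ ?_ ?_)
  · refine isSemialgebraicFunOn_ratFun₁ W.isSemialgebraic_domain (X 0 ^ 4)
      (X 0 ^ 4 + (1 - X 0) ^ 4) φ (fun x _ => ?_) (fun x _ => ?_)
    · simp only [map_add, map_sub, map_pow, MvPolynomial.aeval_X, map_one]
      exact (quartic_den_pos (x 0)).ne'
    · simp [hφ]
  · intro p hp q hq h
    rw [hWd] at hp hq
    exact (quartic_strictMonoOn_subst.injOn (Ioo_subset_Icc_self hp) (Ioo_subset_Icc_self hq) h)
  · rw [hβd, hWd]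
    ext y
    simp only [mem_setOf_eq, mem_image]
    constructor
    · intro hy
      have : y 0 ∈ φ '' Ioo 0 1 := by rw [quartic_image_subst]; exact hy
      obtain ⟨w, hw, hwy⟩ := this
      exact ⟨fun _ => w, hw, funext fun i => by rw [Subsingleton.elim i 0]; exact hwy⟩
    · rintro ⟨p, hp, rfl⟩
      have : φ (p 0) ∈ φ '' Ioo 0 1 := mem_image_of_mem φ hp
      rwa [quartic_image_subst] at this
  · intro p hp
    have hp' : p 0 ∈ Ioo (0:ℝ) 1 := by rw [hWd] at hp; exact hp
    have hφp : (fun _ : Fin 1 => φ (p 0)) ∈ β.domain := by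
      rw [hβd]
      show φ (p 0) ∈ Ioo (0:ℝ) 1
      rw [← quartic_image_subst]
      exact mem_image_of_mem φ hp'
    have hpos : 0 < φ' (p 0) := by
      have h1 : 0 < p 0 := hp'.1
      have h2 : 0 < 1 - p 0 := by linarith [hp'.2]
      have h3 := quartic_den_pos (p 0)
      simp only [hφ']
      positivity
    rw [hWi hp, hβi hφp, abs_of_pos hpos]
    exact (quartic_subst_pullback hp').symm

end Summit.KontsevichZagierPeriods.FermatIsogeny.BetaLinearSector.Quarters

end
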